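import Mathlib
import Literature.AlgebraicGeometry.CossartPiltant200819.Thm15iBaseSidePhase2019
import Literature.AlgebraicGeometry.Resolution.LocalBlowup
import Literature.AlgebraicGeometry.Resolution.QuadraticTransforms
import Literature.AlgebraicGeometry.Resolution.QuadraticTransformsRegular
import Literature.AlgebraicGeometry.Resolution.QuadraticSequenceDimOneExistence
import Summits.ResolutionOfSingularities.ResolutionOfSingularities.Theorems.RadicialJungCleanModelsLens5PRankTwoCurrency
import Summits.ResolutionOfSingularities.ResolutionOfSingularities.Theorems.RadicialJungCleanModelsCleanLU3ArcPackage
import Summits.ResolutionOfSingularities.ResolutionOfSingularities.Theorems.RadicialJungCleanModelsLens5PTwoPhase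
import Summits.ResolutionOfSingularities.ResolutionOfSingularities.Theorems.RadicialJungCleanModelsConeExitPrelims
import HarnessLib

/-!
# Route `RadicialJung`, crux `CleanModels` (stmt-15917), line `Sketch`: TANGENT-CONE EXIT after one quadratic transform — part 2/2 (the dichotomy, and the END of the printed phase)

Line lead `res-B-lead-1` g10, `--supports stmt-ResolutionOfSingularities-15917`.  KERNEL form of the by-hand analysis of the dim-3 research residual at odd `p`
(`Cruxes/CleanModels/Lines/Sketch-memo-rev33-residual.md` §3, lens-5 g19 QK1 §5quater (α)/(β), lead g8/g9 NOTES): Cossart–Piltant's base-side phase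
(INPUTS wi-91399, `Literature.AlgebraicGeometry.CossartPiltant200819.CossartPiltant2019_thm_1_5_i_baseSidePhase`, every `p`) ends with
`e := max_c ord (g_n - c^p) ≤ p - 1` on a regular finitely generated model (✓ `Lens5.PTwo.exists_lowMultModel_of_baseSidePhaseAt`); then

* `e = 0` ⟹ clean in form (2), `e = 1` ⟹ clean in form (3) AT the end ring (this is all of `p = 2`);
* `2 ≤ e ≤ p - 1` (so `p ∤ e`) ⟹ after ONE quadratic transform along the valuation, `h = g_n - c₀^p = x^e · G` with `x` the exceptional parameter
  (a regular parameter of the transform, part 1 `chart_notMem_sq_transform`), and the line is clean in form (1) — `G` a unit (centre OFF the tangent cone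
  `V(in_e h) ⊂ ℙ(𝔪/𝔪²)`) or `G` a regular parameter transversal to `x` (centre a REGULAR point of the cone) — UNLESS `G ∈ 𝔪₁² + (x)`: the centre of the
  valuation on the blown-up model is a SINGULAR point of the projectivised tangent cone (at `p = 3`: the vertex of a rank-2 conic or a point of a double
  line), and then `h ∈ 𝔪₁^{e+1}` (`mem_pow_succ_of_coneVertex`; at `p = 3` the multiplicity is back to `p`: «return»).

Contents: `cleanLUConcl_or_coneVertex` (the dichotomy for any model and any representative `h ∈ 𝔪^e`, `p ∤ e`), `mem_pow_succ_of_coneVertex`,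
`cleanLUConcl_or_firstReturn_of_baseSidePhaseAt` / `…_of_cp2019BaseSidePhase` (every `p`, every valuation ring, every ground field: `CleanLUConcl`, or the
FIRST RETURN configuration with `e` certified intrinsic, `∀ c', h - c'^p ∉ 𝔪^{e+1}`).

Honest framing: OURS · counted 0.  Nothing here proves resolution in characteristic `p`, and no registered stub is closed: the second branch (returns through
singular points of the tangent cone, and their termination) IS the research residual `stub_cleanLU3DefectNonDiscrete` at odd `p` after the printed phase;
this file only makes its first step kernel-exact.
-/

noncomputable section

set_option linter.dupNamespace false

open IsLocalRing
open Literature.AlgebraicGeometry.Resolution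
open Summit.ResolutionOfSingularities.ResolutionOfSingularities.Theorems.RadicialJung.CleanModels.Lens5.PRankTwoCurrency

namespace Summit.ResolutionOfSingularities.ResolutionOfSingularities.Theorems.RadicialJung.CleanModels.ConeExit

universe u

/-! ## §4 The dichotomy after ONE quadratic transform: clean, or the new centre is a singular point of the tangent cone -/

/-- **TANGENT-CONE EXIT (the dichotomy).**  Let `A ⊆ A' ⊆ O` be finitely generated models of `K/k` with `R = locAtCentre A' O` regular, and let
`h = Σ_{j<p} c_j^p g₀^j ∈ R` be a NON-TRIVIAL representative of the `K^p`-line of `g₀` with `h ∈ 𝔪_R^e`, `p ∤ e`.  Let `R₁` be the quadratic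
transform of `R` along `O` (the local ring, at the centre of `O`, of the blowing up of the closed point).  Then EITHER `CleanLUConcl p k K O A g₀`
holds — in form (1) on `R₁`, which is again `locAtCentre` of a finitely generated model: `h = x^e · G` with `x` the exceptional parameter and `G` a
unit («the new centre is OFF the tangent cone `V(in h)`») or `G` a regular parameter transversal to `x` («a REGULAR point of the cone») — OR the
strict factor `G` lies in `𝔪_{R₁}² + (x)`, i.e. the centre of `O` on the blown-up model is a SINGULAR point of the projectivised tangent cone of `h`
(then `h ∈ 𝔪_{R₁}^{e+1}`: the order has gone UP).  The second branch is returned with its bookkeeping (model `A''`, `x`, `G`).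
At `p = 3` after the printed base-side phase (`e = 2`, a ternary quadratic form) the second branch is «the centre is the vertex of a rank-2 cone
or lies on a double line» — the by-hand residual of `Sketch-memo-rev33-residual.md` §3, now kernel-checked. [folklore] -/
theorem cleanLUConcl_or_coneVertex {p : ℕ} (hp : p.Prime) {k K : Type} [Field k] [Field K] [Algebra k K]
    (O : ValuationSubring K) (A A' : Subalgebra k K)
    (hA'O : A'.toSubring ≤ O.toSubring) (hAA' : A ≤ A') (hA'fg : A'.FG)
    (hreg : IsRegularLocalRing (locAtCentre A'.toSubring O)) (g₀ : K)
    (c : Fin p → K) (hc0 : ∃ j : Fin p, (j : ℕ) ≠ 0 ∧ c j ≠ 0)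
    (h : locAtCentre A'.toSubring O) (hc : ∑ j : Fin p, c j ^ p * g₀ ^ (j : ℕ) = (h : K))
    (e : ℕ) (he : ¬ p ∣ e) (hh : h ∈ maximalIdeal (locAtCentre A'.toSubring O) ^ e)
    {R₁ : Subring K} (hq : IsQuadraticTransformAlong O (locAtCentre A'.toSubring O) R₁) :
    CleanLUConcl p k K O A g₀ ∨
    ∃ (A'' : Subalgebra k K) (_ : A''.toSubring ≤ O.toSubring) (_ : A ≤ A'') (_ : A' ≤ A'') (_ : A''.FG)
      (_ : R₁ = locAtCentre A''.toSubring O) (_ : IsRegularLocalRing (locAtCentre A''.toSubring O))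
      (x : locAtCentre A'.toSubring O) (hxR₁ : (x : K) ∈ locAtCentre A''.toSubring O) (G : locAtCentre A''.toSubring O),
      x ∈ maximalIdeal (locAtCentre A'.toSubring O) ∧ (x : K) ≠ 0 ∧
      (∀ y ∈ maximalIdeal (locAtCentre A'.toSubring O), O.valuation (y : K) ≤ O.valuation (x : K)) ∧
      (⟨(x : K), hxR₁⟩ : locAtCentre A''.toSubring O) ∈ maximalIdeal (locAtCentre A''.toSubring O) ∧
      (⟨(x : K), hxR₁⟩ : locAtCentre A''.toSubring O) ∉ maximalIdeal (locAtCentre A''.toSubring O) ^ 2 ∧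
      (h : K) = (x : K) ^ e * (G : K) ∧
      G ∈ maximalIdeal (locAtCentre A''.toSubring O) ^ 2 ⊔ Ideal.span {(⟨(x : K), hxR₁⟩ : locAtCentre A''.toSubring O)} := by
  classical
  haveI := hreg
  set R : Subring K := locAtCentre A'.toSubring O with hRdef
  have hRO : R ≤ O.toSubring := locAtCentre_le hA'O
  have hdom : SubringDominates R O.toSubring := subringDominates_locAtCentre hA'O
  -- the chart element `x` and the model `A''`
  obtain ⟨_, x, hx, hx0, hmin, hR₁eq⟩ := hq.exists_eq_locAtCentre
  have hx0K : (x : K) ≠ 0 := fun h0 => hx0 (Subtype.ext h0)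
  obtain ⟨A'', hA''O, hAA'', hA'A'', hA''fg, hR₁A''⟩ :=
    exists_model_of_isLocalBlowup_with_input_le (A := A) hAA' hA'fg hq.isLocalBlowup
  have hreg₁ : IsRegularLocalRing R₁ := hq.isRegularLocalRing_of_isRegularLocalRing hreg
  obtain ⟨hxR₁, hxm₁, hx2₁⟩ := chart_notMem_sq_transform hq hdom x hx hx0 hmin
  have hT : blowupRing R (x : K) ≤ R₁ := hR₁eq ▸ le_locAtCentre _ O
  obtain ⟨G, hG⟩ := exists_eq_pow_mul_of_mem_pow (R₁ := R₁) hx0K hT hh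
  subst hR₁A''
  haveI := hreg₁
  by_cases hGt : G ∈ maximalIdeal (locAtCentre A''.toSubring O) ^ 2 ⊔
      Ideal.span {(⟨(x : K), hxR₁⟩ : locAtCentre A''.toSubring O)}
  · exact Or.inr ⟨A'', hA''O, hAA'', hA'A'', hA''fg, rfl, hreg₁, x, hxR₁, G, hx, hx0K, hmin, hxm₁, hx2₁, hG, hGt⟩
  · left
    by_cases hGu : IsUnit G
    · -- off the cone: `h = G · x^e`, form (1) with one parameter
      refine cleanLUConcl_of_unit_mul_pow O A A'' hA''O hAA'' hA''fg hreg₁ g₀ ⟨(x : K), hxR₁⟩ hxm₁ hx2₁ G hGu e he c hc0 ?_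
      rw [hc, hG, mul_comm]
    · -- a regular point of the cone: `h = 1 · x^e · G` with `(x, G)` part of a regular system of parameters
      have hGm : G ∈ maximalIdeal (locAtCentre A''.toSubring O) := (mem_maximalIdeal _).mpr hGu
      refine cleanLUConcl_of_unit_mul_pow_mul hp O A A'' hA''O hAA'' hA''fg hreg₁ g₀ ⟨(x : K), hxR₁⟩ hxm₁ hx2₁ G hGm hGt
        1 isUnit_one e he c hc0 ?_
      rw [hc, hG]
      simp

/-- In the second branch of `cleanLUConcl_or_coneVertex` the order goes up: `G ∈ 𝔪₁² + (x)` gives `h = x^e G ∈ 𝔪₁^{e+1}` (`x ∈ 𝔪₁`).  At `p = 3`,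
`e = 2`: `h ∈ 𝔪₁³ = 𝔪₁^p` — the multiplicity of `X^p - h` is back to `p` and the printed base-side phase re-applies («return»). [folklore] -/
theorem mem_pow_succ_of_coneVertex {S : Type u} [CommRing S] [IsLocalRing S] {x G h : S} {e : ℕ}
    (hx : x ∈ maximalIdeal S) (hG : G ∈ maximalIdeal S ^ 2 ⊔ Ideal.span {x}) (hh : h = x ^ e * G) :
    h ∈ maximalIdeal S ^ (e + 1) := by
  obtain ⟨q, hq, r, hr, rfl⟩ := Submodule.mem_sup.mp hG
  obtain ⟨r', rfl⟩ := Ideal.mem_span_singleton'.mp hr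
  rw [hh, mul_add]
  refine Ideal.add_mem _ ?_ ?_
  · have : x ^ e * q ∈ maximalIdeal S ^ (e + 2) := by
      rw [pow_add]; exact Ideal.mul_mem_mul (Ideal.pow_mem_pow hx e) hq
    exact Ideal.pow_le_pow_right (Nat.le_succ _) this
  · have : x ^ e * (r' * x) = r' * x ^ (e + 1) := by ring
    rw [this]
    exact Ideal.mul_mem_left _ _ (Ideal.pow_mem_pow hx (e + 1))

/-! ## §5 After the printed base-side phase (every `p`): clean, or a FIRST RETURN through a singular point of the tangent cone -/

/-- **CLEAN, OR FIRST RETURN — the END of Cossart–Piltant's base-side phase followed by one quadratic transform.**  From the `p`-instance of the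
typed printed theorem `CossartPiltant2019_thm_1_5_i_baseSidePhase` (INPUTS wi-91399; END «multiplicity `< p`») at a 3-dimensional regular centre of a
finitely generated model `A ⊆ O` of `K/k` and `g₀ ∈ K ∖ K^p`: let `R' = locAtCentre A' O` be the END ring (✓ `Lens5.PTwo.exists_lowMultModel_of_baseSidePhaseAt`)
with its representative `G = C^p g₀ + D^p`, and `e := max_c ord_{R'}(G - c^p) ≤ p - 1` its INTRINSIC order.  If `e = 0` the line is clean in form (2)
at `R'`; if `e = 1` in form (3) at `R'`; if `2 ≤ e ≤ p - 1` (so `p ∤ e`), one quadratic transform along `O` gives `CleanLUConcl` unless the new centre is a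
singular point of the tangent cone of `h = G - c₀^p` (`cleanLUConcl_or_coneVertex`), and that configuration is returned, with `e` certified maximal
(`∀ c', h - c'^p ∉ 𝔪^{e+1}`).  Every valuation ring `O`, every ground field; at `p = 2` the second branch is empty (this re-proves the `p = 2` slice
✓ `Lens5.PTwo.cleanLU3_two_of_baseSidePhaseTwo`); at odd `p` it is the honest first obstruction of the dim-3 residual after the printed phase.
[cite: CossartPiltant2019, Thm. 1.5 (i) pp. 271–272; Cor. 5.6 p. 405; Prop. 2.22 pp. 294–295] -/
theorem cleanLUConcl_or_firstReturn_of_baseSidePhaseAt (p : ℕ) (hp : p.Prime)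
    (hBSp : (∀ (S : Type) [CommRing S] [IsRegularLocalRing S],
          IsExcellentRing S → ringKrullDim S = 3 → CharP S p →
          ∀ (K : Type) [Field K] [Algebra S K] [IsFractionRing S K] (f : S),
          (∀ c : K, c ^ p ≠ algebraMap S K f) →
          ∀ (O : ValuationSubring K), (algebraMap S K).range ≤ O.toSubring →
          (∀ s ∈ IsLocalRing.maximalIdeal S, O.valuation (algebraMap S K s) < 1) →
          ∃ (n : ℕ) (B : ℕ → Subring K) (g : ℕ → K),
          B 0 = locAtCentre (algebraMap S K).range O ∧ g 0 = algebraMap S K f ∧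
          (∀ i ≤ n, B i ≤ O.toSubring ∧ IsRegularLocalRing (B i) ∧ g i ∈ B i) ∧
          (∀ i < n, ∃ P : Ideal (B i), IsRegularLocalRing ((B i) ⧸ P) ∧
            IsLocalBlowupAlong O (B i) P (B (i + 1)) ∧
            ∃ c d : K, c ≠ 0 ∧ g (i + 1) = c ^ p * g i + d ^ p) ∧
          ∀ (hg : g n ∈ B n) (_hBn : IsRegularLocalRing (B n)) (c : B n),
            (⟨g n, hg⟩ : B n) - c ^ p ∉ IsLocalRing.maximalIdeal (B n) ^ p))
    (k : Type) [Field k] [CharP k p] (K : Type) [Field K] [Algebra k K]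
    (O : ValuationSubring K) (A : Subalgebra k K) (hAO : A.toSubring ≤ O.toSubring) (hAfg : A.FG)
    (hfrac : IsFractionRing A K) (hreg : IsRegularLocalRing (locAtCentre A.toSubring O))
    (hdim3 : ringKrullDim (locAtCentre A.toSubring O) = 3) (g₀ : K) (hg₀ : ∀ c : K, c ^ p ≠ g₀) :
    CleanLUConcl p k K O A g₀ ∨
    ∃ (A' : Subalgebra k K) (_ : A'.toSubring ≤ O.toSubring) (_ : A ≤ A') (_ : A'.FG)
      (_ : IsRegularLocalRing (locAtCentre A'.toSubring O))
      (c : Fin p → K) (h : locAtCentre A'.toSubring O) (e : ℕ),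
      (∃ j : Fin p, (j : ℕ) ≠ 0 ∧ c j ≠ 0) ∧ (∑ j : Fin p, c j ^ p * g₀ ^ (j : ℕ)) = (h : K) ∧ 2 ≤ e ∧ e < p ∧
      h ∈ maximalIdeal (locAtCentre A'.toSubring O) ^ e ∧
      (∀ c' : locAtCentre A'.toSubring O, h - c' ^ p ∉ maximalIdeal (locAtCentre A'.toSubring O) ^ (e + 1)) ∧
      ∃ (A'' : Subalgebra k K) (_ : A''.toSubring ≤ O.toSubring) (_ : A' ≤ A'') (_ : A''.FG)
        (_ : IsQuadraticTransformAlong O (locAtCentre A'.toSubring O) (locAtCentre A''.toSubring O))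
        (_ : IsRegularLocalRing (locAtCentre A''.toSubring O))
        (x : locAtCentre A'.toSubring O) (hxR₁ : (x : K) ∈ locAtCentre A''.toSubring O) (G : locAtCentre A''.toSubring O),
        x ∈ maximalIdeal (locAtCentre A'.toSubring O) ∧ (x : K) ≠ 0 ∧
        (∀ y ∈ maximalIdeal (locAtCentre A'.toSubring O), O.valuation (y : K) ≤ O.valuation (x : K)) ∧
        (⟨(x : K), hxR₁⟩ : locAtCentre A''.toSubring O) ∈ maximalIdeal (locAtCentre A''.toSubring O) ∧
        (⟨(x : K), hxR₁⟩ : locAtCentre A''.toSubring O) ∉ maximalIdeal (locAtCentre A''.toSubring O) ^ 2 ∧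
        (h : K) = (x : K) ^ e * (G : K) ∧
        G ∈ maximalIdeal (locAtCentre A''.toSubring O) ^ 2 ⊔ Ideal.span {(⟨(x : K), hxR₁⟩ : locAtCentre A''.toSubring O)} := by
  classical
  haveI : Fact p.Prime := ⟨hp⟩
  haveI := hfrac
  haveI : CharP K p := charP_of_injective_algebraMap (algebraMap k K).injective p
  obtain ⟨A', hA'O, hAA', hA'fg, -, hregA', C, D, hGmem, hC, hmultG⟩ :=
    Lens5.PTwo.exists_lowMultModel_of_baseSidePhaseAt p hp hBSp k K O A hAO hAfg hfrac hreg hdim3 g₀ hg₀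
  haveI := hregA'
  have hRO : locAtCentre A'.toSubring O ≤ O.toSubring := locAtCentre_le hA'O
  -- the intrinsic order `e = max_c ord (G - c^p) ≤ p - 1`
  obtain ⟨P, hPdef⟩ : ∃ P : ℕ → Prop, P = fun n => ∃ c' : locAtCentre A'.toSubring O,
      (⟨C ^ p * g₀ + D ^ p, hGmem⟩ : locAtCentre A'.toSubring O) - c' ^ p ∈ maximalIdeal (locAtCentre A'.toSubring O) ^ n :=
    ⟨_, rfl⟩
  have hP0 : P 0 := by rw [hPdef]; exact ⟨0, by simp⟩
  obtain ⟨e, hedef⟩ : ∃ e : ℕ, e = Nat.findGreatest P (p - 1) := ⟨_, rfl⟩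
  have hPe : P e := by rw [hedef]; exact Nat.findGreatest_spec (Nat.zero_le _) hP0
  have hep : e ≤ p - 1 := by rw [hedef]; exact Nat.findGreatest_le (p - 1)
  have helt : e < p := lt_of_le_of_lt hep (Nat.sub_lt hp.pos Nat.one_pos)
  have hnot : ∀ c' : locAtCentre A'.toSubring O,
      (⟨C ^ p * g₀ + D ^ p, hGmem⟩ : locAtCentre A'.toSubring O) - c' ^ p ∉
        maximalIdeal (locAtCentre A'.toSubring O) ^ (e + 1) := by
    intro c' hc'
    by_cases hcase : e + 1 ≤ p - 1
    · have hng : ¬ P (e + 1) := Nat.findGreatest_is_greatest (by rw [← hedef]; exact Nat.lt_succ_self e) hcase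
      apply hng
      rw [hPdef]
      exact ⟨c', hc'⟩
    · have hpe : e + 1 = p := by omega
      rw [hpe] at hc'
      exact hmultG c' hc'
  rw [hPdef] at hPe
  obtain ⟨c₀, hc₀⟩ := hPe
  -- the representative `h = G - c₀^p = C^p g₀ + (D - c₀)^p`
  obtain ⟨h, hhdef⟩ : ∃ h : locAtCentre A'.toSubring O,
      h = (⟨C ^ p * g₀ + D ^ p, hGmem⟩ : locAtCentre A'.toSubring O) - c₀ ^ p := ⟨_, rfl⟩
  have hmax : ∀ c' : locAtCentre A'.toSubring O, h - c' ^ p ∉ maximalIdeal (locAtCentre A'.toSubring O) ^ (e + 1) := by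
    intro c' hc'
    apply hnot (c₀ + c')
    have hpc : (c₀ + c') ^ p = c₀ ^ p + c' ^ p := add_pow_char _ _ _
    have : (⟨C ^ p * g₀ + D ^ p, hGmem⟩ : locAtCentre A'.toSubring O) - (c₀ + c') ^ p = h - c' ^ p := by
      rw [hpc, hhdef]; ring
    rw [this]
    exact hc'
  have hmax0 : h ∉ maximalIdeal (locAtCentre A'.toSubring O) ^ (e + 1) := by
    have := hmax 0
    rwa [zero_pow hp.ne_zero, sub_zero] at this
  have hne0 : (0 : ℕ) ≠ 1 := by norm_num
  let j0 : Fin p := ⟨0, hp.pos⟩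
  let j1 : Fin p := ⟨1, hp.one_lt⟩
  have hj01 : j0 ≠ j1 := by intro hj; exact hne0 (congrArg Fin.val hj)
  let cvec : Fin p → K := fun j => if j = j0 then D - (c₀ : K) else if j = j1 then C else 0
  have hcvec0 : cvec j0 = D - (c₀ : K) := by simp [cvec]
  have hcvec1 : cvec j1 = C := by simp [cvec, hj01.symm]
  have hc0vec : ∃ j : Fin p, (j : ℕ) ≠ 0 ∧ cvec j ≠ 0 := ⟨j1, by simp [j1], by rw [hcvec1]; exact hC⟩
  have hsum : (∑ j : Fin p, cvec j ^ p * g₀ ^ (j : ℕ)) = (h : K) := by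
    rw [Fintype.sum_eq_add j0 j1 hj01 (fun j hj => by simp [cvec, hj.1, hj.2, hp.ne_zero]), hcvec0, hcvec1]
    have hcoe : (h : K) = C ^ p * g₀ + D ^ p - (c₀ : K) ^ p := by
      rw [hhdef]; simp
    rw [hcoe, sub_pow_char]
    simp [j0, j1]
    ring
  -- case analysis on `e`
  rcases Nat.lt_or_ge e 2 with he2 | he2
  · left
    interval_cases e
    · -- `e = 0`: form (2) at the END ring
      have hhu : IsUnit h := by
        by_contra hnu
        apply hmax0
        simpa using (mem_maximalIdeal _).mpr hnu
      refine cleanLUConcl_of_unit_residue O A A' hA'O hAA' hA'fg hregA' g₀ h hhu (fun c' => ?_) cvec hc0vec hsum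
      simpa using hmax c'
    · -- `e = 1`: form (3) at the END ring
      have hh1 : h ∈ maximalIdeal (locAtCentre A'.toSubring O) := by
        rw [hhdef]; simpa using hc₀
      have hh2 : h ∉ maximalIdeal (locAtCentre A'.toSubring O) ^ 2 := hmax0
      exact cleanLUConcl_of_parameter O A A' hA'O hAA' hA'fg hregA' g₀ h hh1 hh2 cvec hsum
  · -- `2 ≤ e < p`: one quadratic transform along `O`
    have hpe : ¬ p ∣ e := fun hd => absurd (Nat.le_of_dvd (by omega) hd) (not_le.mpr helt)
    have hhe : h ∈ maximalIdeal (locAtCentre A'.toSubring O) ^ e := by rw [hhdef]; exact hc₀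
    have hmne : maximalIdeal (locAtCentre A'.toSubring O) ≠ ⊥ := by
      intro hbot
      have hhm : h ∈ maximalIdeal (locAtCentre A'.toSubring O) := Ideal.pow_le_self (by omega) hhe
      rw [hbot] at hhm
      have h0 : h = 0 := (Submodule.mem_bot _).mp hhm
      apply hmax0
      rw [h0]
      exact Submodule.zero_mem _
    obtain ⟨R₁, hq⟩ := exists_isQuadraticTransformAlong (B := locAtCentre A'.toSubring O) hRO hmne
    rcases cleanLUConcl_or_coneVertex hp O A A' hA'O hAA' hA'fg hregA' g₀ cvec hc0vec h hsum e hpe hhe hq with hclean | hret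
    · exact Or.inl hclean
    · obtain ⟨A'', hA''O, -, hA'A'', hA''fg, hR₁eq, hreg₁, x, hxR₁, G, hx, hx0, hmin, hxm₁, hx2₁, hG, hGt⟩ := hret
      refine Or.inr ⟨A', hA'O, hAA', hA'fg, hregA', cvec, h, e, hc0vec, hsum, he2, helt, hhe, hmax,
        A'', hA''O, hA'A'', hA''fg, hR₁eq ▸ hq, hreg₁, x, hxR₁, G, hx, hx0, hmin, hxm₁, hx2₁, hG, hGt⟩

/-- (by name) **CLEAN, OR FIRST RETURN** from the printed fact `CossartPiltant2019_thm_1_5_i_baseSidePhase` BY NAME, every prime `p`: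
`cleanLUConcl_or_firstReturn_of_baseSidePhaseAt p hp (hBS p hp)`. [cite: CossartPiltant2019, Thm. 1.5 (i) pp. 271–272; Cor. 5.6 p. 405] -/
theorem cleanLUConcl_or_firstReturn_of_cp2019BaseSidePhase
    (hBS : Literature.AlgebraicGeometry.CossartPiltant200819.CossartPiltant2019_thm_1_5_i_baseSidePhase.{0}) (p : ℕ) (hp : p.Prime)
    (k : Type) [Field k] [CharP k p] (K : Type) [Field K] [Algebra k K]
    (O : ValuationSubring K) (A : Subalgebra k K) (hAO : A.toSubring ≤ O.toSubring) (hAfg : A.FG)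
    (hfrac : IsFractionRing A K) (hreg : IsRegularLocalRing (locAtCentre A.toSubring O))
    (hdim3 : ringKrullDim (locAtCentre A.toSubring O) = 3) (g₀ : K) (hg₀ : ∀ c : K, c ^ p ≠ g₀) :
    CleanLUConcl p k K O A g₀ ∨
    ∃ (A' : Subalgebra k K) (_ : A'.toSubring ≤ O.toSubring) (_ : A ≤ A') (_ : A'.FG)
      (_ : IsRegularLocalRing (locAtCentre A'.toSubring O))
      (c : Fin p → K) (h : locAtCentre A'.toSubring O) (e : ℕ),
      (∃ j : Fin p, (j : ℕ) ≠ 0 ∧ c j ≠ 0) ∧ (∑ j : Fin p, c j ^ p * g₀ ^ (j : ℕ)) = (h : K) ∧ 2 ≤ e ∧ e < p ∧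
      h ∈ maximalIdeal (locAtCentre A'.toSubring O) ^ e ∧
      (∀ c' : locAtCentre A'.toSubring O, h - c' ^ p ∉ maximalIdeal (locAtCentre A'.toSubring O) ^ (e + 1)) ∧
      ∃ (A'' : Subalgebra k K) (_ : A''.toSubring ≤ O.toSubring) (_ : A' ≤ A'') (_ : A''.FG)
        (_ : IsQuadraticTransformAlong O (locAtCentre A'.toSubring O) (locAtCentre A''.toSubring O))
        (_ : IsRegularLocalRing (locAtCentre A''.toSubring O))
        (x : locAtCentre A'.toSubring O) (hxR₁ : (x : K) ∈ locAtCentre A''.toSubring O) (G : locAtCentre A''.toSubring O),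
        x ∈ maximalIdeal (locAtCentre A'.toSubring O) ∧ (x : K) ≠ 0 ∧
        (∀ y ∈ maximalIdeal (locAtCentre A'.toSubring O), O.valuation (y : K) ≤ O.valuation (x : K)) ∧
        (⟨(x : K), hxR₁⟩ : locAtCentre A''.toSubring O) ∈ maximalIdeal (locAtCentre A''.toSubring O) ∧
        (⟨(x : K), hxR₁⟩ : locAtCentre A''.toSubring O) ∉ maximalIdeal (locAtCentre A''.toSubring O) ^ 2 ∧
        (h : K) = (x : K) ^ e * (G : K) ∧
        G ∈ maximalIdeal (locAtCentre A''.toSubring O) ^ 2 ⊔ Ideal.span {(⟨(x : K), hxR₁⟩ : locAtCentre A''.toSubring O)} :=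
  cleanLUConcl_or_firstReturn_of_baseSidePhaseAt p hp (hBS p hp) k K O A hAO hAfg hfrac hreg hdim3 g₀ hg₀


end Summit.ResolutionOfSingularities.ResolutionOfSingularities.Theorems.RadicialJung.CleanModels.ConeExit

end
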